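import Summits.BirchSwinnertonDyer.Rank1Residual.X11b.LocalTorsionAwayFromP
import HarnessLib

/-!
# X11b, route R1 — statement of record with the control input SPLIT along the census: two
# Poitou–Tate atoms on the locally-trivial pairs, four atoms elsewhere

HONEST FRAMING (cell `b2b-bsdres`, run/shared/lean/b2b/bsd-rank1-residual/, verbatim in every
file): the goal of the cell is to DELETE the COMBINATION-SHAPED residual classes of the
Birch–Swinnerton-Dyer formula for ALL analytic-rank `≤ 1` elliptic curves over `ℚ` — "full BSD
formula for every rank `≤ 1` curve in class `C`" assembled STRICTLY from published theorems — so
that the rank-`≤ 1` remainder becomes exactly the CONSTRUCTION-SHAPED classes, which are TYPED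
(missing-input `Prop`s), NOT attempted. This is not "finishing BSD". Sub-cell
`b2b-bsdres-multr1-p1` (X11b, route R1 = Castella 2018 Thm. A re-proved along the author's
erratum); a RESEARCH ROUTE; no claim beyond the stated class; X11b stays CONSTRUCTION-SHAPED;
nothing here changes a label; no named fact is minted (theorems only; no `sorry`).

## What this file proves

Gen 12 decomposed the PUB-shaped control input `R1ControlOnTreeAt` (Cas18 Thm. 2.3 at every datum
of route R1) into typed atoms with all glue kernel-proved:
`R1PoitouTateAtomsAt ∧ R1LocalKernelOrderAt ⟹ R1ControlOnTreeAt` in general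
(`r1ControlOnTreeAt_of_atoms`) and `R1TwoAtomsAt ⟹ R1ControlOnTreeAt` on the pairs with
`LocallyTrivialAt W p` (`r1ControlOnTreeAt_of_two_atoms`; numeric form
`r1ControlOnTreeAt_of_two_atoms_of_not_dvd`; census: 88.3 % of `ChainLocus` below `5·10⁵`).
This file records the resulting statements of record:

* `r1ControlOnTreeAt_of_split_atoms` — (CTL) at `(W, p)` from: two atoms if `LocallyTrivialAt W p`,
  four atoms otherwise;
* **`R1.bsdp_of_onTree_split_atoms`** — for every globally minimal elliptic `W/ℚ` and prime `p` on
  `R1Population` with `ord_{s=1} L(E,s) = 1`: `BSD(E,p)` from the NINE PUBLISHED named facts of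
  `R1.bsdp`, the typed atoms supplied ALONG THE SPLIT (at locally-trivial pairs: (P6) JSW17
  Prop. 3.2.1/(7.1.5) and (L10) Lemma 3.3.3 only; elsewhere also (P9) Prop. 3.3.2 and (P11)
  Prop. 3.3.4 Case 1(a)), and the ONE OPEN input `R1OpenInputOnTreeAt` ((IMC)∘(BDP) at `𝟙`,
  erratum Thm. 1.1 ⇐ [FW21, Thm. 4.41], PREPRINT);
* `R1.bsdp_of_onTree_two_atoms_of_not_dvd` — at a pair passing the numeric test
  `p ∤ c_ℓ(E)·N_ℓ` (`ℓ ∣ N_E`, `ℓ ≠ p`) the same with the two-atom input at THAT pair and the four-atom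
  input required only at the other pairs of the `∀`-form (bookkeeping of the conditional).

CONDITIONAL; deletes nothing; X11b stays CONSTRUCTION-SHAPED; no label change.

References: [Castella2018] Thm. 2.3, §5 (arXiv:1704.06608 pp. 5, 12); [Castella2018Erratum] Thm. 1.1,
Thm. A′ (p. 1); [JetchevSkinnerWan2017] Thm. 3.3.1, Prop. 3.2.1, Prop. 3.3.2, Lemma 3.3.3, Prop. 3.3.4
(arXiv:1512.06894 pp. 10–13).
-/

noncomputable section

open scoped Classical

open WeierstrassCurve NumberField IsDedekindDomain Field
open Literature.NumberTheory.EllipticCurves Literature.NumberTheory.EllipticCurves.ModularForms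
open Literature.NumberTheory.EllipticCurves.Rank1Residual
open Literature.NumberTheory.EllipticCurves.Rank1Residual.Typed

namespace Summit.BirchSwinnertonDyer.Rank1Residual.X11b

section Split

variable (W : WeierstrassCurve ℚ) [W.IsElliptic] [W.IsGloballyMinimal] (p : ℕ) [Fact p.Prime]

/-- **(CTL) along the split**: two atoms on a locally-trivial pair, four atoms otherwise.
[cite: Castella2018, Thm. 2.3 (arXiv:1704.06608 p. 5)] [cite: JetchevSkinnerWan2017, Thm. 3.3.1 (arXiv:1512.06894 p. 11)] -/
theorem r1ControlOnTreeAt_of_split_atoms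
    (h2 : LocallyTrivialAt W p → R1TwoAtomsAt W p)
    (h4 : ¬ LocallyTrivialAt W p → R1PoitouTateAtomsAt W p ∧ R1LocalKernelOrderAt W p) :
    R1ControlOnTreeAt W p := by
  by_cases hLT : LocallyTrivialAt W p
  · exact r1ControlOnTreeAt_of_two_atoms W p hLT (h2 hLT)
  · exact r1ControlOnTreeAt_of_atoms W p (h4 hLT).1 (h4 hLT).2

/-- **Route R1 — statement of record with the control input split along the census.** For every
globally minimal elliptic `W/ℚ` and prime `p` on `R1Population` with `ord_{s=1} L(E,s) = 1`:
`BSD(E,p)`, from the NINE PUBLISHED named facts of `R1.bsdp` (Gross–Zagier 1986 I.7.3, GZK,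
Skinner 2016 Thm. C, modularity, Cai–Shu–Tian 2014 Thm. 1.1, Friedberg–Hoffstein 1995 Thm. B,
Mazur 1978 Cor. 4.1, Néron mapping property), the typed control atoms — on pairs with
`LocallyTrivialAt` the TWO Poitou–Tate shapes (P6) JSW17 Prop. 3.2.1/(7.1.5) and (L10) Lemma 3.3.3,
on the other pairs the three Poitou–Tate shapes (P6), (P9), (L10) and the local shape (P11) — and
the ONE OPEN input `R1OpenInputOnTreeAt` ((IMC)∘(BDP) at `𝟙`: erratum Thm. 1.1 ⇐ [FW21, Thm. 4.41],
PREPRINT, composed with Cas18 Thm. 3.2). Everything else (Castella §5; JSW17 §3.3's control map,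
Lemmas 3.1–3.3, descents, the `Σ(N⁺) → ∅` passage, the Euler-characteristic form, the local kernels
where `E(K_w)[p] = 0`, the Tamagawa bookkeeping) is a tree theorem. CONDITIONAL; deletes nothing;
X11b stays CONSTRUCTION-SHAPED; no label change. [cite: Castella2018, §5 (arXiv:1704.06608 p. 12)]
[cite: Castella2018Erratum, Thm. 1.1, Thm. A′ (p. 1)] [cite: JetchevSkinnerWan2017, Thm. 3.3.1 (arXiv:1512.06894 p. 11)] -/
theorem R1.bsdp_of_onTree_split_atoms
    (hGZ : GrossZagier1986_thm_I_7_3) (hGZK : rank_eq_analyticRank_of_analyticRank_le_one)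
    (hSk : Skinner2016.thmC_padicValRat_bsd_rank_zero) (hmod : exists_isNewformOf)
    (hCST : CaiShuTian2014.thm11_trivialChar)
    (hFH : friedbergHoffstein_exists_twist_ne_zero_ramifiedAt)
    (hMaz : mazur_not_dvd_maninConstant_of_odd) (hNS : integral_neronScaling_of_isGloballyMinimal)
    (h2 : ∀ (W : WeierstrassCurve ℚ) [W.IsElliptic] [W.IsGloballyMinimal] (p : ℕ) [Fact p.Prime],
      LocallyTrivialAt W p → R1TwoAtomsAt W p)
    (h4 : ∀ (W : WeierstrassCurve ℚ) [W.IsElliptic] [W.IsGloballyMinimal] (p : ℕ) [Fact p.Prime],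
      ¬ LocallyTrivialAt W p → R1PoitouTateAtomsAt W p ∧ R1LocalKernelOrderAt W p)
    (hA : ∀ (W : WeierstrassCurve ℚ) [W.IsElliptic] [W.IsGloballyMinimal] (p : ℕ) [Fact p.Prime],
      R1OpenInputOnTreeAt W p)
    (hW : R1Population W p) (hr : W.analyticRank = 1) : BSDp W p :=
  R1.bsdp_of_onTree hGZ hGZK hSk hmod hCST hFH hMaz hNS
    (fun W _ _ p _ ↦ r1ControlOnTreeAt_of_split_atoms W p (h2 W p) (h4 W p)) hA W p hW hr

/-- **At a pair passing the numeric test** `p ∤ c_ℓ(E)·N_ℓ` for every `ℓ ∣ N_E`, `ℓ ≠ p` (the test of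
census3; `N_ℓ = #Ẽ_ns(𝔽_ℓ)`): the pair is locally trivial (`locallyTrivialAt_of_not_dvd`), so the
two-atom input (P6) ∧ (L10) is what the statement of record consumes there.
[cite: Castella2018, Thm. 2.3 (arXiv:1704.06608 p. 5)] [cite: SilvermanAEC2009, VII.2 Prop. 2.1, VII.3 Prop. 3.1] -/
theorem R1.bsdp_of_onTree_two_atoms_of_not_dvd
    (hGZ : GrossZagier1986_thm_I_7_3) (hGZK : rank_eq_analyticRank_of_analyticRank_le_one)
    (hSk : Skinner2016.thmC_padicValRat_bsd_rank_zero) (hmod : exists_isNewformOf)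
    (hCST : CaiShuTian2014.thm11_trivialChar)
    (hFH : friedbergHoffstein_exists_twist_ne_zero_ramifiedAt)
    (hMaz : mazur_not_dvd_maninConstant_of_odd) (hNS : integral_neronScaling_of_isGloballyMinimal)
    (h2 : ∀ (W : WeierstrassCurve ℚ) [W.IsElliptic] [W.IsGloballyMinimal] (p : ℕ) [Fact p.Prime],
      LocallyTrivialAt W p → R1TwoAtomsAt W p)
    (h4 : ∀ (W : WeierstrassCurve ℚ) [W.IsElliptic] [W.IsGloballyMinimal] (p : ℕ) [Fact p.Prime],
      ¬ LocallyTrivialAt W p → R1PoitouTateAtomsAt W p ∧ R1LocalKernelOrderAt W p)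
    (hA : ∀ (W : WeierstrassCurve ℚ) [W.IsElliptic] [W.IsGloballyMinimal] (p : ℕ) [Fact p.Prime],
      R1OpenInputOnTreeAt W p)
    (hnum : ∀ (ℓ : ℕ) [Fact ℓ.Prime], ℓ ∣ W.conductorNorm ℤ → ℓ ≠ p →
      ¬ p ∣ (W.baseChange ((ratPlace ℓ).adicCompletion ℚ)).localTamagawaNumber
          ((ratPlace ℓ).adicCompletionIntegers ℚ) * reductionPointCount W ℓ)
    (hW : R1Population W p) (hr : W.analyticRank = 1) : LocallyTrivialAt W p ∧ BSDp W p :=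
  ⟨locallyTrivialAt_of_not_dvd W p hnum,
    R1.bsdp_of_onTree_split_atoms W p hGZ hGZK hSk hmod hCST hFH hMaz hNS h2 h4 hA hW hr⟩

end Split

end Summit.BirchSwinnertonDyer.Rank1Residual.X11b

end
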